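import Literature.NumberTheory.Automorphic.UnitaryGroupDirectSumCarriers
import HarnessLib

/-!
# The centraliser of a block scalar `a·1_{N₁} ⊕ b·1_{N₂}` (`a − b` a unit) in `U(J₁ ⊕ J₂)` is the block-diagonal subgroup
# `U(J₁) × U(J₂)` — over any commutative ring, and on adelic points
(Rogawski, *Automorphic Representations of Unitary Groups in Three Variables* (1990), §3.8 Prop. 3.8.1 (a): the centraliser of a singular,
non-central, semisimple element of `U(3)` is `U(2) × U(1)`-type)

Topic `NumberTheory/Automorphic`; namespace `Literature.NumberTheory.Automorphic.UnitaryGroup`.  THEOREMS ONLY (no definition, no instance,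
no named fact, no `sorry`), over the tree's block-diagonal embeddings ★ `blockDiagGL` ∕ `reindexGL` ∕ `blockDiagFin` ∕ `finSum`
(`UnitaryGroupDirectSum`) and ★ `adelicBlockDiag` (`UnitaryGroupDirectSumCarriers`).

* §1 (any commutative ring `S`, `a b : S` with `a − b` a unit, sizes `N₁, N₂`) `finSum_mul_finSum`, `finSum_inj`, **`eq_finSum_of_commute`**:
  a matrix commuting with `D = a·1 ⊕ᶠ b·1` IS block diagonal, `x = x₁ ⊕ᶠ x₂` (the off-diagonal blocks `B`, `C` of `x` satisfy
  `(a − b) B = 0 = (a − b) C`); `commute_finSum_smul_one` (the converse).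
* §2 **`mem_range_blockDiagFin_iff_commute`** — for `g ∈ U_σ(J₁ ⊕ᶠ J₂)(S)`: `g` lies in the image of `U_σ(J₁) × U_σ(J₂)` (★ `blockDiagFin`)
  iff `g` commutes with `D` (both `g` and `g⁻¹` are block diagonal, the blocks are mutually inverse, and unitarity is read blockwise).
* §3 ADELIC POINTS (`E/F` with involution `c`, `J₁ ∈ M_{N₁}(E)`, `J₂ ∈ M_{N₂}(E)`, `a ≠ b` in `E`): for every rational `δ ∈ U(J₁ ⊕ᶠ J₂)(F)`
  with matrix `a·1 ⊕ᶠ b·1`, **`centralizer_toAdelic_eq_range_adelicBlockDiag`** — the centraliser of `δ ⊗ 1` in `U(J₁ ⊕ᶠ J₂)(𝔸_F)` IS the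
  image of ★ `adelicBlockDiag : U(J₁)(𝔸_F) × U(J₂)(𝔸_F) →* U(J₁ ⊕ᶠ J₂)(𝔸_F)` (`a − b ≠ 0` stays a unit in `𝔸_E`).
This is the algebraic half of [Rogawski1990, Prop. 3.8.1 (a)] «`G_γ ≅ H′_ξ × E¹`» for the frame `γ P = P (a·1₂ ⊕ b·1₁)`, `ᵗ(σP)HP = H_a ⊕ H_b`
of ★ `Rogawski1990.exists_singular_frame`; the topological half (`≃ₜ*` by the open-mapping theorem) and the orbital measures follow in
`UnitaryGroupAdelicCentralizerProduct`.

## References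
* J. Rogawski, *Automorphic Representations of Unitary Groups in Three Variables*, Ann. of Math. Stud. 123 (1990), §3.8 Prop. 3.8.1 (a)
  p. 27 [Rogawski1990].
-/

noncomputable section

open scoped MatrixGroups
open NumberField

namespace Literature.NumberTheory.Automorphic.UnitaryGroup

/-! ## §1 Matrices commuting with a block scalar are block diagonal -/

section Algebra

variable {S : Type*} [CommRing S] {N₁ N₂ : ℕ}

/-- `(A ⊕ᶠ B)(C ⊕ᶠ D) = AC ⊕ᶠ BD`. [folklore] -/
private theorem finSum_mul_finSum (A C : Matrix (Fin N₁) (Fin N₁) S) (B D : Matrix (Fin N₂) (Fin N₂) S) :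
    finSum N₁ N₂ A B * finSum N₁ N₂ C D = finSum N₁ N₂ (A * C) (B * D) := by
  simp only [finSum, Matrix.reindex_apply, Matrix.submatrix_mul_equiv, Matrix.fromBlocks_multiply, Matrix.mul_zero, Matrix.zero_mul,
    add_zero, zero_add]

/-- `⊕ᶠ` is injective in the pair of blocks. [folklore] -/
private theorem finSum_inj {A C : Matrix (Fin N₁) (Fin N₁) S} {B D : Matrix (Fin N₂) (Fin N₂) S} (h : finSum N₁ N₂ A B = finSum N₁ N₂ C D) :
    A = C ∧ B = D := by
  have h' := (Matrix.reindex finSumFinEquiv finSumFinEquiv).injective h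
  rw [Matrix.fromBlocks_inj] at h'
  exact ⟨h'.1, h'.2.2.2⟩

/-- `1 = 1 ⊕ᶠ 1`. [folklore] -/
private theorem finSum_one_one : finSum N₁ N₂ (1 : Matrix (Fin N₁) (Fin N₁) S) (1 : Matrix (Fin N₂) (Fin N₂) S) = 1 := by
  simp only [finSum, Matrix.fromBlocks_one, Matrix.reindex_apply, Matrix.submatrix_one_equiv]

/-- **A matrix commuting with the block scalar `a·1 ⊕ᶠ b·1`, `a − b` a unit, is block diagonal**: its off-diagonal blocks `B`, `C` satisfy
`b B = a B`, `a C = b C`. [cite: Rogawski1990, §3.8 Prop. 3.8.1 p. 27] -/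
theorem eq_finSum_of_commute {a b : S} (hab : IsUnit (a - b)) (x : Matrix (Fin (N₁ + N₂)) (Fin (N₁ + N₂)) S)
    (hx : x * finSum N₁ N₂ (a • (1 : Matrix (Fin N₁) (Fin N₁) S)) (b • (1 : Matrix (Fin N₂) (Fin N₂) S)) =
      finSum N₁ N₂ (a • (1 : Matrix (Fin N₁) (Fin N₁) S)) (b • (1 : Matrix (Fin N₂) (Fin N₂) S)) * x) :
    ∃ (x₁ : Matrix (Fin N₁) (Fin N₁) S) (x₂ : Matrix (Fin N₂) (Fin N₂) S), x = finSum N₁ N₂ x₁ x₂ := by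
  -- read `x` in the `Fin N₁ ⊕ Fin N₂` indexing
  set y : Matrix (Fin N₁ ⊕ Fin N₂) (Fin N₁ ⊕ Fin N₂) S := x.submatrix finSumFinEquiv finSumFinEquiv with hydef
  have hxy : x = Matrix.reindex finSumFinEquiv finSumFinEquiv y := by
    rw [hydef, Matrix.reindex_apply, Matrix.submatrix_submatrix, Equiv.self_comp_symm, Matrix.submatrix_id_id]
  set D₀ : Matrix (Fin N₁ ⊕ Fin N₂) (Fin N₁ ⊕ Fin N₂) S :=
    Matrix.fromBlocks (a • (1 : Matrix (Fin N₁) (Fin N₁) S)) 0 0 (b • (1 : Matrix (Fin N₂) (Fin N₂) S)) with hD₀def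
  have hy : y * D₀ = D₀ * y := by
    have h := congrArg (fun M : Matrix (Fin (N₁ + N₂)) (Fin (N₁ + N₂)) S => M.submatrix ⇑finSumFinEquiv ⇑finSumFinEquiv) hx
    rw [finSum, Matrix.reindex_apply, ← Matrix.submatrix_mul_equiv x _ ⇑finSumFinEquiv finSumFinEquiv ⇑finSumFinEquiv,
      ← Matrix.submatrix_mul_equiv _ x ⇑finSumFinEquiv finSumFinEquiv ⇑finSumFinEquiv, Matrix.submatrix_submatrix,
      Equiv.symm_comp_self, Matrix.submatrix_id_id] at h
    exact h
  -- blockwise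
  have hyb := Matrix.fromBlocks_toBlocks y
  rw [← hyb, hD₀def, Matrix.fromBlocks_multiply, Matrix.fromBlocks_multiply] at hy
  simp only [Matrix.mul_zero, Matrix.zero_mul, add_zero, zero_add, Matrix.mul_smul, Matrix.smul_mul, Matrix.mul_one, Matrix.one_mul,
    Matrix.fromBlocks_inj] at hy
  obtain ⟨-, h₁₂, h₂₁, -⟩ := hy
  -- `(a - b) • B = 0`, `(a - b) • C = 0`
  obtain ⟨u, hu⟩ := hab
  have hB : y.toBlocks₁₂ = 0 := by
    have h : (a - b) • y.toBlocks₁₂ = 0 := by rw [sub_smul, ← h₁₂, sub_self]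
    have h2 := congrArg (fun M => (↑u⁻¹ : S) • M) h
    simp only [smul_smul, ← hu, Units.inv_mul, one_smul, smul_zero] at h2
    exact h2
  have hC : y.toBlocks₂₁ = 0 := by
    have h : (a - b) • y.toBlocks₂₁ = 0 := by rw [sub_smul, h₂₁, sub_self]
    have h2 := congrArg (fun M => (↑u⁻¹ : S) • M) h
    simp only [smul_smul, ← hu, Units.inv_mul, one_smul, smul_zero] at h2
    exact h2
  refine ⟨y.toBlocks₁₁, y.toBlocks₂₂, ?_⟩
  conv_lhs => rw [hxy, ← hyb, hB, hC]
  rfl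

/-- Conversely a block-diagonal matrix commutes with every block scalar. [cite: Rogawski1990, §3.8 Prop. 3.8.1 p. 27] -/
theorem finSum_commute_finSum_smul_one (a b : S) (x₁ : Matrix (Fin N₁) (Fin N₁) S) (x₂ : Matrix (Fin N₂) (Fin N₂) S) :
    finSum N₁ N₂ x₁ x₂ * finSum N₁ N₂ (a • (1 : Matrix (Fin N₁) (Fin N₁) S)) (b • (1 : Matrix (Fin N₂) (Fin N₂) S)) =
      finSum N₁ N₂ (a • (1 : Matrix (Fin N₁) (Fin N₁) S)) (b • (1 : Matrix (Fin N₂) (Fin N₂) S)) * finSum N₁ N₂ x₁ x₂ := by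
  rw [finSum_mul_finSum, finSum_mul_finSum, Matrix.mul_smul, Matrix.smul_mul, Matrix.mul_smul, Matrix.smul_mul, Matrix.mul_one,
    Matrix.one_mul, Matrix.mul_one, Matrix.one_mul]

/-! ## §2 In `U_σ(J₁ ⊕ᶠ J₂)`: the image of `U_σ(J₁) × U_σ(J₂)` is the centraliser of a block scalar -/

/-- The matrix of `blockDiagFin σ J₁ J₂ (g₁, g₂)` is `g₁ ⊕ᶠ g₂`. [folklore] -/
private theorem coe_coe_blockDiagFin (σ : S →+* S) (J₁ : Matrix (Fin N₁) (Fin N₁) S) (J₂ : Matrix (Fin N₂) (Fin N₂) S)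
    (g : unitaryGroupOfForm σ J₁ × unitaryGroupOfForm σ J₂) :
    (((blockDiagFin σ J₁ J₂ g : unitaryGroupOfForm σ (finSum N₁ N₂ J₁ J₂)) : GL (Fin (N₁ + N₂)) S) : Matrix _ _ S) =
      finSum N₁ N₂ ((g.1 : GL (Fin N₁) S) : Matrix _ _ S) ((g.2 : GL (Fin N₂) S) : Matrix _ _ S) := by
  rw [coe_blockDiagFin, finSum, Matrix.reindex_apply]

/-- **`U_σ(J₁) × U_σ(J₂)` is the centraliser of a block scalar in `U_σ(J₁ ⊕ᶠ J₂)`**: for `a − b` a unit, `g ∈ U_σ(J₁ ⊕ᶠ J₂)(S)` lies in the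
image of ★ `blockDiagFin` iff it commutes with `a·1 ⊕ᶠ b·1`.  (⇐): `g` and `g⁻¹` are block diagonal (§1) with mutually inverse blocks,
and `ᵗ(σg)(J₁ ⊕ J₂)g = J₁ ⊕ J₂` reads blockwise. [cite: Rogawski1990, §3.8 Prop. 3.8.1 p. 27] -/
theorem mem_range_blockDiagFin_iff_commute (σ : S →+* S) (J₁ : Matrix (Fin N₁) (Fin N₁) S) (J₂ : Matrix (Fin N₂) (Fin N₂) S)
    {a b : S} (hab : IsUnit (a - b)) (g : unitaryGroupOfForm σ (finSum N₁ N₂ J₁ J₂)) :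
    g ∈ (blockDiagFin σ J₁ J₂).range ↔
      ((g : GL (Fin (N₁ + N₂)) S) : Matrix _ _ S) * finSum N₁ N₂ (a • (1 : Matrix (Fin N₁) (Fin N₁) S)) (b • 1) =
        finSum N₁ N₂ (a • (1 : Matrix (Fin N₁) (Fin N₁) S)) (b • 1) * ((g : GL (Fin (N₁ + N₂)) S) : Matrix _ _ S) := by
  constructor
  · rintro ⟨u, rfl⟩
    rw [coe_coe_blockDiagFin]
    exact finSum_commute_finSum_smul_one a b _ _
  · intro hg
    -- `g` and `g⁻¹` are block diagonal
    obtain ⟨x₁, x₂, hx⟩ := eq_finSum_of_commute hab _ hg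
    have hg' : (((g : GL (Fin (N₁ + N₂)) S)⁻¹ : GL _ S) : Matrix _ _ S) * finSum N₁ N₂ (a • (1 : Matrix (Fin N₁) (Fin N₁) S)) (b • 1) =
        finSum N₁ N₂ (a • (1 : Matrix (Fin N₁) (Fin N₁) S)) (b • 1) * (((g : GL (Fin (N₁ + N₂)) S)⁻¹ : GL _ S) : Matrix _ _ S) := by
      have h := congrArg (fun M => (((g : GL (Fin (N₁ + N₂)) S)⁻¹ : GL _ S) : Matrix _ _ S) * M *
        (((g : GL (Fin (N₁ + N₂)) S)⁻¹ : GL _ S) : Matrix _ _ S)) hg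
      simp only [← Matrix.mul_assoc, Matrix.coe_units_inv, Matrix.nonsing_inv_mul _ (Matrix.isUnits_det_units _), Matrix.one_mul] at h
      simp only [Matrix.mul_assoc, Matrix.mul_nonsing_inv _ (Matrix.isUnits_det_units _), Matrix.mul_one] at h
      rw [← Matrix.coe_units_inv] at h
      exact h.symm
    obtain ⟨y₁, y₂, hy⟩ := eq_finSum_of_commute hab _ hg'
    -- the blocks are mutually inverse
    have hxy : x₁ * y₁ = 1 ∧ x₂ * y₂ = 1 := by
      apply finSum_inj
      rw [← finSum_mul_finSum, ← hx, ← hy, ← Units.val_mul, mul_inv_cancel, Units.val_one, finSum_one_one]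
    have hyx : y₁ * x₁ = 1 ∧ y₂ * x₂ = 1 := by
      apply finSum_inj
      rw [← finSum_mul_finSum, ← hx, ← hy, ← Units.val_mul, inv_mul_cancel, Units.val_one, finSum_one_one]
    let u₁ : GL (Fin N₁) S := ⟨x₁, y₁, hxy.1, hyx.1⟩
    let u₂ : GL (Fin N₂) S := ⟨x₂, y₂, hxy.2, hyx.2⟩
    have hgu : (g : GL (Fin (N₁ + N₂)) S) = reindexGL finSumFinEquiv (blockDiagGL (u₁, u₂)) := by
      apply Units.ext
      rw [hx, coe_reindexGL, coe_blockDiagGL, finSum]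
    -- unitarity blockwise
    have hmem : blockDiagGL (u₁, u₂) ∈ unitaryGroupOfForm σ (Matrix.fromBlocks J₁ 0 0 J₂) := by
      have h := g.2
      rw [hgu, finSum, reindexGL_mem_iff] at h
      exact h
    have hblocks : u₁ ∈ unitaryGroupOfForm σ J₁ ∧ u₂ ∈ unitaryGroupOfForm σ J₂ := by
      rw [mem_unitaryGroupOfForm_iff, coe_blockDiagGL, Matrix.fromBlocks_map, Matrix.fromBlocks_transpose, Matrix.fromBlocks_multiply,
        Matrix.fromBlocks_multiply] at hmem
      simp only [Matrix.map_zero σ (map_zero σ), Matrix.transpose_zero, Matrix.mul_zero, Matrix.zero_mul, add_zero, zero_add,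
        Matrix.fromBlocks_inj] at hmem
      rw [mem_unitaryGroupOfForm_iff, mem_unitaryGroupOfForm_iff]
      exact ⟨hmem.1, hmem.2.2.2⟩
    refine ⟨(⟨u₁, hblocks.1⟩, ⟨u₂, hblocks.2⟩), Subtype.ext ?_⟩
    rw [coe_blockDiagFin_eq, hgu]

end Algebra

/-! ## §3 Adelic points: the centraliser of `δ ⊗ 1`, `δ = a·1 ⊕ᶠ b·1` rational, is the image of `U(J₁)(𝔸) × U(J₂)(𝔸)` -/

section Adelic

variable (F E : Type) [Field F] [NumberField F] [Field E] [NumberField E] [Algebra F E]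
  (c : E ≃ₐ[F] E) (M₁ M₂ : ℕ) (J₁ : Matrix (Fin M₁) (Fin M₁) E) (J₂ : Matrix (Fin M₂) (Fin M₂) E)

omit [NumberField F] in
/-- The matrix of `adelicBlockDiag (u₁, u₂)` is `u₁ ⊕ᶠ u₂`. [folklore] -/
private theorem coe_coe_adelicBlockDiag (u : adelic F E c M₁ J₁ × adelic F E c M₂ J₂) :
    (((adelicBlockDiag F E c M₁ M₂ J₁ J₂ u : adelic F E c (M₁ + M₂) (finSum M₁ M₂ J₁ J₂)) : GL (Fin (M₁ + M₂)) (AdeleRing (𝓞 E) E)) :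
        Matrix (Fin (M₁ + M₂)) (Fin (M₁ + M₂)) (AdeleRing (𝓞 E) E)) =
      finSum M₁ M₂ ((u.1 : GL (Fin M₁) (AdeleRing (𝓞 E) E)) : Matrix (Fin M₁) (Fin M₁) (AdeleRing (𝓞 E) E))
        ((u.2 : GL (Fin M₂) (AdeleRing (𝓞 E) E)) : Matrix (Fin M₂) (Fin M₂) (AdeleRing (𝓞 E) E)) := by
  rw [coe_adelicBlockDiag, coe_reindexGL, coe_blockDiagGL]
  rfl

omit [NumberField F] in
/-- The matrix of `toAdelic δ` for `δ = a·1 ⊕ᶠ b·1` is `(a ⊗ 1)·1 ⊕ᶠ (b ⊗ 1)·1`. [folklore] -/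
private theorem coe_toAdelic_of_eq_finSum {a b : E} (δ : rational F E c (M₁ + M₂) (finSum M₁ M₂ J₁ J₂))
    (hδ : ((δ : GL (Fin (M₁ + M₂)) E) : Matrix _ _ E) = finSum M₁ M₂ (a • (1 : Matrix (Fin M₁) (Fin M₁) E)) (b • 1)) :
    (((toAdelic F E c (M₁ + M₂) (finSum M₁ M₂ J₁ J₂) δ : adelic F E c (M₁ + M₂) (finSum M₁ M₂ J₁ J₂)) :
        GL (Fin (M₁ + M₂)) (AdeleRing (𝓞 E) E)) : Matrix _ _ (AdeleRing (𝓞 E) E)) =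
      finSum M₁ M₂ (algebraMap E (AdeleRing (𝓞 E) E) a • (1 : Matrix (Fin M₁) (Fin M₁) (AdeleRing (𝓞 E) E)))
        (algebraMap E (AdeleRing (𝓞 E) E) b • 1) := by
  have h1 : (((toAdelic F E c (M₁ + M₂) (finSum M₁ M₂ J₁ J₂) δ : adelic F E c (M₁ + M₂) (finSum M₁ M₂ J₁ J₂)) :
      GL (Fin (M₁ + M₂)) (AdeleRing (𝓞 E) E)) : Matrix (Fin (M₁ + M₂)) (Fin (M₁ + M₂)) (AdeleRing (𝓞 E) E)) =
      Matrix.map ((δ : GL (Fin (M₁ + M₂)) E) : Matrix (Fin (M₁ + M₂)) (Fin (M₁ + M₂)) E) (algebraMap E (AdeleRing (𝓞 E) E)) := by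
    have h0 : ((toAdelic F E c (M₁ + M₂) (finSum M₁ M₂ J₁ J₂) δ : adelic F E c (M₁ + M₂) (finSum M₁ M₂ J₁ J₂)) :
        GL (Fin (M₁ + M₂)) (AdeleRing (𝓞 E) E)) =
        Matrix.GeneralLinearGroup.map (algebraMap E (AdeleRing (𝓞 E) E)) (δ : GL (Fin (M₁ + M₂)) E) := rfl
    rw [h0]
    rfl
  rw [h1, hδ, finSum_map]
  congr 1 <;>
    rw [Matrix.map_smul' _ _ _ (map_mul (algebraMap E (AdeleRing (𝓞 E) E))), Matrix.map_one _ (map_zero _) (map_one _)]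

omit [NumberField F] in
/-- (⇒) An adelic point commuting with `δ ⊗ 1` (`δ = a·1 ⊕ᶠ b·1` rational, `a ≠ b`) is block diagonal: it lies in the image of
★ `adelicBlockDiag`. [cite: Rogawski1990, §3.8 Prop. 3.8.1 p. 27] -/
theorem mem_range_adelicBlockDiag_of_commute {a b : E} (hab : a ≠ b)
    (δ : rational F E c (M₁ + M₂) (finSum M₁ M₂ J₁ J₂))
    (hδ : ((δ : GL (Fin (M₁ + M₂)) E) : Matrix _ _ E) = finSum M₁ M₂ (a • (1 : Matrix (Fin M₁) (Fin M₁) E)) (b • 1))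
    (z : adelic F E c (M₁ + M₂) (finSum M₁ M₂ J₁ J₂))
    (hz : z * toAdelic F E c (M₁ + M₂) (finSum M₁ M₂ J₁ J₂) δ = toAdelic F E c (M₁ + M₂) (finSum M₁ M₂ J₁ J₂) δ * z) :
    z ∈ (adelicBlockDiag F E c M₁ M₂ J₁ J₂).range := by
  have hunit : IsUnit (algebraMap E (AdeleRing (𝓞 E) E) a - algebraMap E (AdeleRing (𝓞 E) E) b) := by
    rw [← map_sub]
    exact ((sub_ne_zero.2 hab).isUnit).map _
  -- `z` as an element of `U(c ⊗ 1, (J₁ ⊗ 1) ⊕ᶠ (J₂ ⊗ 1))`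
  set z' : unitaryGroupOfForm (conjAdele F E c) (finSum M₁ M₂ (adelicForm E M₁ J₁) (adelicForm E M₂ J₂)) :=
    MulEquiv.subgroupCongr (adelic_finSum F E c M₁ M₂ J₁ J₂) z with hz'def
  have hz'z : (z' : GL (Fin (M₁ + M₂)) (AdeleRing (𝓞 E) E)) = (z : GL (Fin (M₁ + M₂)) (AdeleRing (𝓞 E) E)) :=
    MulEquiv.subgroupCongr_apply _ _
  have key := mem_range_blockDiagFin_iff_commute (conjAdele F E c) (adelicForm E M₁ J₁) (adelicForm E M₂ J₂) hunit z'
  rw [hz'z] at key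
  have hcomm : ((z : GL (Fin (M₁ + M₂)) (AdeleRing (𝓞 E) E)) : Matrix (Fin (M₁ + M₂)) (Fin (M₁ + M₂)) (AdeleRing (𝓞 E) E)) *
      finSum M₁ M₂ (algebraMap E (AdeleRing (𝓞 E) E) a • (1 : Matrix (Fin M₁) (Fin M₁) _)) (algebraMap E (AdeleRing (𝓞 E) E) b • 1) =
      finSum M₁ M₂ (algebraMap E (AdeleRing (𝓞 E) E) a • (1 : Matrix (Fin M₁) (Fin M₁) _)) (algebraMap E (AdeleRing (𝓞 E) E) b • 1) *
        ((z : GL (Fin (M₁ + M₂)) (AdeleRing (𝓞 E) E)) : Matrix (Fin (M₁ + M₂)) (Fin (M₁ + M₂)) (AdeleRing (𝓞 E) E)) := by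
    rw [← coe_toAdelic_of_eq_finSum F E c M₁ M₂ J₁ J₂ δ hδ]
    have h := congrArg (fun w : adelic F E c (M₁ + M₂) (finSum M₁ M₂ J₁ J₂) =>
      ((w : GL (Fin (M₁ + M₂)) (AdeleRing (𝓞 E) E)) : Matrix (Fin (M₁ + M₂)) (Fin (M₁ + M₂)) (AdeleRing (𝓞 E) E))) hz
    simp only [Subgroup.coe_mul, Units.val_mul] at h
    exact h
  obtain ⟨u, hu⟩ := key.2 hcomm
  refine ⟨u, Subtype.ext ?_⟩
  rw [coe_adelicBlockDiag, ← coe_blockDiagFin_eq, hu, hz'z]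

omit [NumberField F] in
/-- (⇐) Block-diagonal adelic points commute with `δ ⊗ 1`. [cite: Rogawski1990, §3.8 Prop. 3.8.1 p. 27] -/
theorem adelicBlockDiag_mul_toAdelic_comm {a b : E} (δ : rational F E c (M₁ + M₂) (finSum M₁ M₂ J₁ J₂))
    (hδ : ((δ : GL (Fin (M₁ + M₂)) E) : Matrix _ _ E) = finSum M₁ M₂ (a • (1 : Matrix (Fin M₁) (Fin M₁) E)) (b • 1))
    (u : adelic F E c M₁ J₁ × adelic F E c M₂ J₂) :
    adelicBlockDiag F E c M₁ M₂ J₁ J₂ u * toAdelic F E c (M₁ + M₂) (finSum M₁ M₂ J₁ J₂) δ =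
      toAdelic F E c (M₁ + M₂) (finSum M₁ M₂ J₁ J₂) δ * adelicBlockDiag F E c M₁ M₂ J₁ J₂ u := by
  apply Subtype.ext
  apply Units.ext
  rw [Subgroup.coe_mul, Subgroup.coe_mul, Units.val_mul, Units.val_mul, coe_toAdelic_of_eq_finSum F E c M₁ M₂ J₁ J₂ δ hδ,
    coe_coe_adelicBlockDiag]
  exact finSum_commute_finSum_smul_one (algebraMap E (AdeleRing (𝓞 E) E) a) (algebraMap E (AdeleRing (𝓞 E) E) b)
    ((u.1 : GL (Fin M₁) (AdeleRing (𝓞 E) E)) : Matrix (Fin M₁) (Fin M₁) (AdeleRing (𝓞 E) E))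
    ((u.2 : GL (Fin M₂) (AdeleRing (𝓞 E) E)) : Matrix (Fin M₂) (Fin M₂) (AdeleRing (𝓞 E) E))

omit [NumberField F] in
/-- **The adelic centraliser of a rational block scalar is `U(J₁)(𝔸_F) × U(J₂)(𝔸_F)`**: for `a ≠ b` in `E` and a rational
`δ ∈ U(J₁ ⊕ᶠ J₂)(F)` with matrix `a·1 ⊕ᶠ b·1`, the centraliser of `δ ⊗ 1` in `U(J₁ ⊕ᶠ J₂)(𝔸_F)` is the image of ★ `adelicBlockDiag`
(`a − b ≠ 0` is a unit of the `E`-algebra `𝔸_E`). [cite: Rogawski1990, §3.8 Prop. 3.8.1 p. 27] -/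
theorem centralizer_toAdelic_eq_range_adelicBlockDiag {a b : E} (hab : a ≠ b)
    (δ : rational F E c (M₁ + M₂) (finSum M₁ M₂ J₁ J₂))
    (hδ : ((δ : GL (Fin (M₁ + M₂)) E) : Matrix _ _ E) = finSum M₁ M₂ (a • (1 : Matrix (Fin M₁) (Fin M₁) E)) (b • 1)) :
    Subgroup.centralizer ({toAdelic F E c (M₁ + M₂) (finSum M₁ M₂ J₁ J₂) δ} : Set (adelic F E c (M₁ + M₂) (finSum M₁ M₂ J₁ J₂))) =
      (adelicBlockDiag F E c M₁ M₂ J₁ J₂).range := by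
  ext z
  rw [Subgroup.mem_centralizer_singleton_iff]
  constructor
  · exact mem_range_adelicBlockDiag_of_commute F E c M₁ M₂ J₁ J₂ hab δ hδ z
  · rintro ⟨u, rfl⟩
    exact adelicBlockDiag_mul_toAdelic_comm F E c M₁ M₂ J₁ J₂ δ hδ u

end Adelic

end Literature.NumberTheory.Automorphic.UnitaryGroup
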